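import Literature.Analysis.FluidPDE.BoundedMildWeakL3RieszPressure
import Literature.Analysis.FluidPDE.LocalEnergySolutionsOn
import Literature.Analysis.FluidPDE.KatoPressureTails
import HarnessLib

/-!
# Bounded mild solutions on a window with weak-`L³` datum are local energy solutions in
# Seregin's class (hypothesis `hLE` of the weak-`L³` backward Liouville theorem)

Analysis/FluidPDE proof file (theorems only: no definition, no named fact, no `sorry`) on the
discharge path of the named fact
`Literature.Analysis.FluidPDE.AlbrittonBarker2019_liouville_weakL3_backward`
(`AncientL3BackwardLiouville.lean`; Albritton–Barker, arXiv:1811.00502, **Thm. 4.1**). It proves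
hypothesis `hLE` of `AlbrittonBarker2019_liouville_weakL3_backward_of_localEnergy_of_layer`
(`AncientWeakL3BackwardLiouvilleAssembly.lean`): a field `u` continuous and bounded on
`[0, S] × ℝ³`, with weakly divergence-free slices, solving the Oseen integral equation
`u(t) = e^{(t−s)Δ}u(s) − B¹_s(u, u)(t)` for `0 ≤ s < t ≤ S`, whose datum `u(0)` is a weak-`L³`
field, is — paired with its space–time Riesz pressure `p ∈ L²((0,S) × ℝ³)`
(`BoundedMildWeakL3RieszPressure.lean`) — a local energy solution on `ℝ³ × (0, S)` in Seregin's
class `IsLocalEnergySolutionOn` (Seregin 2014, Def. B.1; this is the statement "`v^{(k)}` is a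
weak `L^{3,∞}` solution on `ℝ³ × ]−1, 0[`" of the source's proof, arXiv p. 9, in the tree's
local energy language, Barker–Seregin–Šverák 2018, Def. 1.1). The clauses: suitability and the
pressure class from the sibling file; the uniformly local gradient bound up to `t = 0` by the
local energy inequality tested with `σ_δ(t)χ_R(x − x₀)` (Lemarié-Rieusset 2016, proof of
Thm. 14.2, p. 499; the tree's `IsKatoSolutionOn.uniformLocalGradient_of_suitable` transcribed for
a bounded velocity and an `L²` pressure, the cubic and pressure terms being estimated on the
box `(0,S) × B_{3R}(x₀)`); the every-time energy bound from boundedness; weak continuity and the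
initial condition from the joint continuity; the decay at spatial infinity from
`u ∈ L⁴((0,S) × ℝ³)`.

* `enorm_lei_integrand_plateauCutoff_le_ball` — the pointwise bound of the local energy
  integrand, localised to the box;
* `uniformLocalGradient_of_suitable_of_bounded` — `sup_{x₀} ∫₀ˢ∫_{B_R(x₀)} |∇u|² < ∞`;
* `continuousOn_integral_inner_of_continuousOn`, `tendsto_lintegral_sub_initial_of_continuousOn`,
  `tendsto_lintegral_box_cocompact_of_memLp_four` — weak continuity, initial condition, decay;
* `isLocalEnergySolutionOn_of_oseenForward`, `exists_isLocalEnergySolutionOn_of_oseenForward` —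
  the assembly, in the shape of hypothesis `hLE`.

## References

* D. Albritton, T. Barker, arXiv:1811.00502, proof of Thm. 4.1 (p. 9). [`AlbrittonBarker2019`]
* T. Barker, G. Seregin, V. Šverák, arXiv:1603.03211, Def. 1.1. [`BarkerSeregin2016`]
* G. Seregin, *Lecture Notes on Regularity Theory for the Navier–Stokes Equations* (2014),
  App. B, Def. B.1. [`Seregin2014`]
* P. G. Lemarié-Rieusset, *The Navier–Stokes Problem in the 21st Century* (2016), Thm. 14.2,
  proof (p. 499); Thm. 15.1 (A). [`LemarieRieusset2016`]
-/

noncomputable section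

open MeasureTheory TopologicalSpace Set Function Filter Metric InnerProductSpace
open _root_.Topology
open scoped ENNReal NNReal RealInnerProductSpace Laplacian

namespace Literature.Analysis.FluidPDE

/-! ### The pointwise bound on the local energy integrand, localised to the box -/

section Pointwise

variable {δ S R ν C₁ C₂ : ℝ} {x₀ : (EuclideanSpace ℝ (Fin 3))}

/-- **Pointwise bound on the right-hand side of the local energy inequality** tested with
`φ = σ(t) χ_R(x - x₀)`, with the cubic and pressure terms localised to the box
`(0,S) × B_{3R}(x₀)` (outside which `φ` and all its derivatives vanish); otherwise the bound of
`enorm_lei_integrand_plateauCutoff_le`. [folklore] -/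
theorem enorm_lei_integrand_plateauCutoff_le_ball (hδ : 0 < δ) (hR : 0 < R) (hν : 0 ≤ ν)
    (hC₁ : ∀ y : (EuclideanSpace ℝ (Fin 3)), ‖fderiv ℝ (cutoff R) y‖ ≤ C₁ / R)
    (hC₂ : ∀ y : (EuclideanSpace ℝ (Fin 3)), |(Δ (cutoff R : (EuclideanSpace ℝ (Fin 3)) → ℝ)) y| ≤ C₂ / R ^ 2)
    (u : ℝ → (EuclideanSpace ℝ (Fin 3)) → (EuclideanSpace ℝ (Fin 3))) (p : ℝ → (EuclideanSpace ℝ (Fin 3)) → ℝ) (t : ℝ) (x : (EuclideanSpace ℝ (Fin 3))) :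
    ‖‖u t x‖ ^ 2 * (timeDeriv (plateauCutoff δ S R x₀) t x + ν * (Δ (plateauCutoff δ S R x₀ t)) x) +
        (‖u t x‖ ^ 2 + 2 * p t x) * ⟪u t x, gradient (plateauCutoff δ S R x₀ t) x⟫ +
        2 * ⟪(0 : ℝ → (EuclideanSpace ℝ (Fin 3)) → (EuclideanSpace ℝ (Fin 3))) t x, u t x⟫ * plateauCutoff δ S R x₀ t x‖ₑ ≤
      (Ioo 0 S).indicator (fun t => ENNReal.ofReal (|deriv (timePlateau δ S) t| + ν * (C₂ / R ^ 2))) t *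
          (ball x₀ (3 * R)).indicator (fun x => ‖u t x‖ₑ ^ 2) x +
        (Ioo 0 S ×ˢ ball x₀ (3 * R)).indicator
          (fun z : ℝ × (EuclideanSpace ℝ (Fin 3)) => ENNReal.ofReal (C₁ / R) *
            (‖u z.1 z.2‖ₑ ^ (3 : ℝ) + 2 * (‖p z.1 z.2‖ₑ * ‖u z.1 z.2‖ₑ))) (t, x) := by
  have hC₁0 : 0 ≤ C₁ / R := le_trans (norm_nonneg _) (hC₁ 0)
  have hC₂0 : 0 ≤ C₂ / R ^ 2 := le_trans (abs_nonneg _) (hC₂ 0)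
  -- the pieces of the test function
  rw [timeDeriv_plateauCutoff, laplacian_plateauCutoff]
  simp only [Pi.zero_apply, inner_zero_left, mul_zero, zero_mul, add_zero]
  set σt := timePlateau δ S t with hσt
  set σ't := deriv (timePlateau δ S) t with hσ't
  set χ := cutoff R (x - x₀) with hχ
  set Lχ := (Δ (cutoff R : (EuclideanSpace ℝ (Fin 3)) → ℝ)) (x - x₀) with hLχ
  have hgrad : ‖gradient (plateauCutoff δ S R x₀ t) x‖ ≤ C₁ / R :=
    norm_gradient_plateauCutoff_le hC₁ δ S x₀ t x
  by_cases ht : t ∈ Ioo 0 S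
  · by_cases hx : x ∈ ball x₀ (3 * R)
    · -- the generic case
      rw [indicator_of_mem ht, indicator_of_mem hx, indicator_of_mem (show (t, x) ∈ Ioo 0 S ×ˢ
        ball x₀ (3 * R) from ⟨ht, hx⟩)]
      dsimp only
      have hσ0 : 0 ≤ σt := timePlateau_nonneg δ S t
      have hσ1 : σt ≤ 1 := timePlateau_le_one δ S t
      have hχ0 : 0 ≤ χ := cutoff_nonneg _ _
      have hχ1 : χ ≤ 1 := cutoff_le_one _ _
      have hL : |Lχ| ≤ C₂ / R ^ 2 := hC₂ _
      set a := ‖u t x‖ with ha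
      have ha0 : 0 ≤ a := norm_nonneg _
      -- real bound
      have h1 : |a ^ 2 * (σ't * χ + ν * (σt * Lχ))| ≤ (|σ't| + ν * (C₂ / R ^ 2)) * a ^ 2 := by
        rw [abs_mul, abs_of_nonneg (sq_nonneg a), mul_comm]
        refine mul_le_mul_of_nonneg_right ((abs_add_le _ _).trans (add_le_add ?_ ?_)) (sq_nonneg a)
        · rw [abs_mul, abs_of_nonneg hχ0]
          calc |σ't| * χ ≤ |σ't| * 1 := mul_le_mul_of_nonneg_left hχ1 (abs_nonneg _)
            _ = |σ't| := mul_one _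
        · rw [abs_mul, abs_of_nonneg hν, abs_mul, abs_of_nonneg hσ0]
          refine mul_le_mul_of_nonneg_left ?_ hν
          calc σt * |Lχ| ≤ 1 * (C₂ / R ^ 2) := mul_le_mul hσ1 hL (abs_nonneg _) zero_le_one
            _ = C₂ / R ^ 2 := one_mul _
      have h2 : |(a ^ 2 + 2 * p t x) * ⟪u t x, gradient (plateauCutoff δ S R x₀ t) x⟫| ≤
          (C₁ / R) * (a ^ 3 + 2 * (|p t x| * a)) := by
        rw [abs_mul]
        have hin : |⟪u t x, gradient (plateauCutoff δ S R x₀ t) x⟫| ≤ a * (C₁ / R) :=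
          (abs_real_inner_le_norm _ _).trans (mul_le_mul_of_nonneg_left hgrad ha0)
        have hfac : |a ^ 2 + 2 * p t x| ≤ a ^ 2 + 2 * |p t x| := by
          refine (abs_add_le _ _).trans ?_
          rw [abs_of_nonneg (sq_nonneg a), abs_mul, abs_two]
        calc |a ^ 2 + 2 * p t x| * |⟪u t x, gradient (plateauCutoff δ S R x₀ t) x⟫|
            ≤ (a ^ 2 + 2 * |p t x|) * (a * (C₁ / R)) :=
              mul_le_mul hfac hin (abs_nonneg _) (by positivity)
          _ = (C₁ / R) * (a ^ 3 + 2 * (|p t x| * a)) := by ring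
      have h12 := (abs_add_le _ _).trans (add_le_add h1 h2)
      -- to `ℝ≥0∞`
      have e1 : ‖u t x‖ₑ ^ 2 = ENNReal.ofReal (a ^ 2) := by
        rw [ha, ← ofReal_norm, ENNReal.ofReal_pow (norm_nonneg _)]
      have e2 : ‖u t x‖ₑ ^ (3 : ℝ) = ENNReal.ofReal (a ^ 3) := by
        rw [ENNReal.rpow_ofNat, ha, ← ofReal_norm, ENNReal.ofReal_pow (norm_nonneg _)]
      have e3 : ‖p t x‖ₑ * ‖u t x‖ₑ = ENNReal.ofReal (|p t x| * a) := by
        rw [Real.enorm_eq_ofReal_abs, ha, ← ofReal_norm, ENNReal.ofReal_mul (abs_nonneg _)]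
      have e4 : (2 : ℝ≥0∞) * ENNReal.ofReal (|p t x| * a) = ENNReal.ofReal (2 * (|p t x| * a)) := by
        rw [ENNReal.ofReal_mul zero_le_two, ENNReal.ofReal_ofNat]
      rw [Real.enorm_eq_ofReal_abs, e1, e2, e3, e4,
        ← ENNReal.ofReal_add (by positivity : (0 : ℝ) ≤ a ^ 3)
          (by positivity : (0 : ℝ) ≤ 2 * (|p t x| * a)),
        ← ENNReal.ofReal_mul hC₁0,
        ← ENNReal.ofReal_mul (by positivity : (0 : ℝ) ≤ |σ't| + ν * (C₂ / R ^ 2)),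
        ← ENNReal.ofReal_add (by positivity : (0 : ℝ) ≤ (|σ't| + ν * (C₂ / R ^ 2)) * a ^ 2)
          (by positivity : (0 : ℝ) ≤ C₁ / R * (a ^ 3 + 2 * (|p t x| * a)))]
      exact ENNReal.ofReal_le_ofReal h12
    · -- outside `B_{3R}(x₀)` the test function and its derivatives vanish
      have hxx : 2 * R < ‖x - x₀‖ := by
        rw [mem_ball, dist_eq_norm, not_lt] at hx; linarith
      have hχ0 : χ = 0 := cutoff_eq_zero hR hxx.le
      have hL0 : Lχ = 0 := laplacian_cutoff_eq_zero_of_two_mul_lt hR hxx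
      have hg0 : gradient (plateauCutoff δ S R x₀ t) x = 0 := by
        rw [gradient, fderiv_plateauCutoff, fderiv_cutoff_eq_zero_of_two_mul_lt hR hxx, smul_zero,
          map_zero]
      rw [hχ0, hL0, hg0]
      simp
  · -- outside `(0, S)` the time plateau and its derivative vanish
    have ht' : t ∉ Ioo δ (S - δ) := fun h => ht ⟨hδ.trans h.1, h.2.trans (by linarith)⟩
    have hσ0 : σt = 0 := timePlateau_eq_zero_of_notMem hδ ht'
    have hσ'0 : σ't = 0 := deriv_timePlateau_eq_zero_of_notMem hδ ht'
    have hg0 : gradient (plateauCutoff δ S R x₀ t) x = 0 := by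
      rw [gradient, fderiv_plateauCutoff, ← hσt, hσ0, zero_smul, map_zero]
    rw [hσ0, hσ'0, hg0]
    simp


end Pointwise

/-! ### The uniformly local gradient bound up to `t = 0` -/

section Gradient

variable {S : ℝ} {u : ℝ → (EuclideanSpace ℝ (Fin 3)) → (EuclideanSpace ℝ (Fin 3))}

/-- **The uniformly local `L²` bound on the gradient up to `t = 0` for a bounded suitable weak
solution with `L²` pressure** (Lemarié-Rieusset 2016, Thm. 14.2 and its proof, p. 499: "apply
the local energy inequality to the test function `φ(s,x) = γ(s)φ₀(x - x₀)`"; transcription of the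
tree's `IsKatoSolutionOn.uniformLocalGradient_of_suitable`). Let `u` be continuous on
`[0, S] × ℝ³` with `|u| ≤ K`, and let `p ∈ L²((0,S) × ℝ³)` make `(u, p)` a suitable weak solution
on the open slab `(0, S) × ℝ³` at unit viscosity. Then the weak spatial gradient `G = ∇u` of the
suitable structure satisfies `sup_{x₀} ∫₀ˢ∫_{B_R(x₀)} |∇u|² < ∞` for every `R > 0`: the local
energy inequality tested with `σ_δ(t)χ_R(x − x₀)` bounds `2∫_{2δ}^{S−2δ}∫_{B_R(x₀)} |∇u|²` by
`(2 + S C₂/R²) K²|B_{3R}| + (C₁/R)(K³ S|B_{3R}| + 2K ‖p‖_{L²} (S|B_{3R}|)^{1/2})`, uniformly in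
`x₀` and `δ`; `δ → 0` by monotone convergence. [cite: LemarieRieusset2016, Thm. 14.2, proof (p. 499)] -/
theorem uniformLocalGradient_of_suitable_of_bounded
    (hcont : ContinuousOn (uncurry u) (Icc 0 S ×ˢ univ)) {K : ℝ}
    (hK : ∀ t ∈ Icc 0 S, ∀ x, ‖u t x‖ ≤ K) {p : ℝ → (EuclideanSpace ℝ (Fin 3)) → ℝ}
    (hsuit : IsSuitableWeakSolutionOn (slab (EuclideanSpace ℝ (Fin 3)) (Ioo 0 S) isOpen_Ioo) 1 0 u p)
    (hp2 : MemLp (uncurry p) 2 (volume.restrict (Ioo 0 S ×ˢ (univ : Set (EuclideanSpace ℝ (Fin 3)))))) :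
    ∃ G : ℝ → (EuclideanSpace ℝ (Fin 3)) → (EuclideanSpace ℝ (Fin 3)) →L[ℝ] (EuclideanSpace ℝ (Fin 3)), HasWeakSpatialGradientOn (slab (EuclideanSpace ℝ (Fin 3)) (Ioo 0 S) isOpen_Ioo) u G ∧
      ∀ R : ℝ, 0 < R → ∃ C : ℝ≥0, ∀ x₀ : (EuclideanSpace ℝ (Fin 3)),
        ∫⁻ z in Ioo 0 S ×ˢ ball x₀ R, ENNReal.ofReal (frobeniusNormSq (G z.1 z.2)) ≤ C := by
  obtain ⟨G, hG, hG2, hLEI⟩ := hsuit.localEnergy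
  refine ⟨G, hG, fun R hR => ?_⟩
  obtain ⟨C₁, -, hC₁'⟩ := exists_norm_fderiv_cutoff_le (E := (EuclideanSpace ℝ (Fin 3)))
  obtain ⟨C₂, -, hC₂'⟩ := exists_abs_laplacian_cutoff_le (E := (EuclideanSpace ℝ (Fin 3)))
  have hC₁ := hC₁' R hR
  have hC₂ := hC₂' R hR
  have hν : (0 : ℝ) < 1 := one_pos
  set ν : ℝ := 1 with hν_def
  have hc₂ : 0 ≤ ν * (C₂ / R ^ 2) := mul_nonneg hν.le (le_trans (abs_nonneg _) (hC₂ 0))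
  have hC₁0 : 0 ≤ C₁ / R := le_trans (norm_nonneg _) (hC₁ 0)
  -- measurability data on the strip
  set strip : Set (ℝ × (EuclideanSpace ℝ (Fin 3))) := Ioo 0 S ×ˢ (univ : Set (EuclideanSpace ℝ (Fin 3))) with hstrip
  have hstrip_m : MeasurableSet strip := measurableSet_Ioo.prod MeasurableSet.univ
  have hum : AEStronglyMeasurable (uncurry u) (volume.restrict strip) :=
    (hcont.mono (prod_mono Ioo_subset_Icc_self subset_rfl)).aestronglyMeasurable hstrip_m
  have hpm : AEStronglyMeasurable (uncurry p) (volume.restrict strip) :=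
    hsuit.distributional.2.2.1.aestronglyMeasurable
  have h1 : AEMeasurable (fun z : ℝ × (EuclideanSpace ℝ (Fin 3)) => ‖u z.1 z.2‖ₑ) (volume.restrict strip) :=
    hum.aemeasurable.enorm
  have h2 : AEMeasurable (fun z : ℝ × (EuclideanSpace ℝ (Fin 3)) => ‖p z.1 z.2‖ₑ) (volume.restrict strip) :=
    hpm.aemeasurable.enorm
  -- the finite quantities: energy on balls of radius `3R` (boundedness), the volume of the
  -- boxes `(0,S) × B_{3R}(x₀)`, and the pressure mass `∫∫ |p|²` on the strip
  set V₃ : ℝ≥0∞ := volume (ball (0 : (EuclideanSpace ℝ (Fin 3))) (3 * R)) with hV₃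
  have hV₃top : V₃ < ∞ := measure_ball_lt_top
  set E₂ : ℝ≥0∞ := ENNReal.ofReal (K ^ 2) * V₃ with hE₂_def
  have hE₂top : E₂ < ∞ := ENNReal.mul_lt_top ENNReal.ofReal_lt_top hV₃top
  have hE₂ : ∀ t ∈ Icc 0 S, ∀ x₀ : (EuclideanSpace ℝ (Fin 3)), ∫⁻ x in ball x₀ (3 * R), ‖u t x‖ₑ ^ 2 ≤ E₂ := by
    intro t ht x₀
    calc ∫⁻ x in ball x₀ (3 * R), ‖u t x‖ₑ ^ 2 ≤ ∫⁻ _ in ball x₀ (3 * R), ENNReal.ofReal (K ^ 2) := by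
          refine lintegral_mono fun x => ?_
          rw [← ofReal_norm, ← ENNReal.ofReal_pow (norm_nonneg _)]
          exact ENNReal.ofReal_le_ofReal (pow_le_pow_left₀ (norm_nonneg _) (hK t ht x) 2)
      _ = E₂ := by rw [setLIntegral_const, Measure.addHaar_ball_center volume x₀, hE₂_def, hV₃]
  set VB : ℝ≥0∞ := volume (Ioo (0 : ℝ) S) * V₃ with hVB
  have hVBtop : VB < ∞ := ENNReal.mul_lt_top measure_Ioo_lt_top hV₃top
  set P₂ := ∫⁻ z in strip, ‖p z.1 z.2‖ₑ ^ (2 : ℝ) with hP₂_def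
  have hP₂top : P₂ < ∞ := lintegral_enorm_rpow_lt_top_of_memLp_two hp2
  -- the two constants of the pointwise bound of `Φ` on the box: `Φ ≤ A₀ + B₀ |p|`
  set A₀ : ℝ≥0∞ := ENNReal.ofReal (C₁ / R) * ENNReal.ofReal (K ^ 3) with hA₀
  set B₀ : ℝ≥0∞ := ENNReal.ofReal (C₁ / R) * (2 * ENNReal.ofReal K) with hB₀
  have hA₀top : A₀ ≠ ∞ := ENNReal.mul_ne_top ENNReal.ofReal_ne_top ENNReal.ofReal_ne_top
  have hB₀top : B₀ ≠ ∞ := ENNReal.mul_ne_top ENNReal.ofReal_ne_top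
    (ENNReal.mul_ne_top ENNReal.ofNat_ne_top ENNReal.ofReal_ne_top)
  set B : ℝ≥0∞ := (2 + ENNReal.ofReal (ν * (C₂ / R ^ 2)) * ENNReal.ofReal S) * E₂ +
    (A₀ * VB + B₀ * (P₂ ^ (1 / 2 : ℝ) * VB ^ (1 / 2 : ℝ))) with hB
  have hBtop : B ≠ ∞ := by
    refine ENNReal.add_ne_top.2 ⟨ENNReal.mul_ne_top (ENNReal.add_ne_top.2 ⟨by norm_num,
      ENNReal.mul_ne_top ENNReal.ofReal_ne_top ENNReal.ofReal_ne_top⟩) hE₂top.ne,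
      ENNReal.add_ne_top.2 ⟨ENNReal.mul_ne_top hA₀top hVBtop.ne,
        ENNReal.mul_ne_top hB₀top (ENNReal.mul_ne_top
          (ENNReal.rpow_ne_top_of_nonneg (by norm_num) hP₂top.ne)
          (ENNReal.rpow_ne_top_of_nonneg (by norm_num) hVBtop.ne))⟩⟩
  have h2ν : ENNReal.ofReal (2 * ν) ≠ 0 := (ENNReal.ofReal_pos.2 (by positivity)).ne'
  refine ⟨(B / ENNReal.ofReal (2 * ν)).toNNReal, fun x₀ => ?_⟩
  rw [ENNReal.coe_toNNReal (ENNReal.div_lt_top hBtop h2ν).ne]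
  -- Step 1: the bound on the boxes `(2δ, S - 2δ) × B_R(x₀)`
  have key : ∀ δ : ℝ, 0 < δ → 4 * δ ≤ S →
      ∫⁻ z in Ioo (2 * δ) (S - 2 * δ) ×ˢ ball x₀ R, ENNReal.ofReal (frobeniusNormSq (G z.1 z.2)) ≤
        B / ENNReal.ofReal (2 * ν) := by
    intro δ hδ hδS
    set φ := plateauCutoff δ S R x₀ with hφ_def
    have hφ : IsSpaceTimeTestOn (slab (EuclideanSpace ℝ (Fin 3)) (Ioo 0 S) isOpen_Ioo) φ :=
      isSpaceTimeTestOn_plateauCutoff hδ hR S x₀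
    have hle := hLEI φ hφ (plateauCutoff_nonneg δ S R x₀)
    set box : Set (ℝ × (EuclideanSpace ℝ (Fin 3))) := Ioo (2 * δ) (S - 2 * δ) ×ˢ ball x₀ R with hbox
    -- (L) the left-hand side dominates the box integral
    set Kφ : Set (ℝ × (EuclideanSpace ℝ (Fin 3))) := tsupport (uncurry φ) with hKφ
    have hKc : IsCompact Kφ := hφ.hasCompactSupport
    have hKQ : Kφ ⊆ ((slab (EuclideanSpace ℝ (Fin 3)) (Ioo 0 S) isOpen_Ioo : Opens (ℝ × (EuclideanSpace ℝ (Fin 3)))) : Set (ℝ × (EuclideanSpace ℝ (Fin 3)))) :=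
      hφ.tsupport_subset
    set F : ℝ × (EuclideanSpace ℝ (Fin 3)) → ℝ := fun z => frobeniusNormSq (G z.1 z.2) * φ z.1 z.2 with hF
    have hF0 : ∀ z, 0 ≤ F z := fun z =>
      mul_nonneg (frobeniusNormSq_nonneg _) (plateauCutoff_nonneg δ S R x₀ _ _)
    have hFle : ∀ z, F z ≤ frobeniusNormSq (G z.1 z.2) := fun z =>
      mul_le_of_le_one_right (frobeniusNormSq_nonneg _) (plateauCutoff_le_one δ S R x₀ _ _)
    have hFsupp : support F ⊆ Kφ := fun z hz => by
      have hz' : φ z.1 z.2 ≠ 0 := fun h => hz (by simp only [hF, h, mul_zero])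
      exact subset_tsupport _ hz'
    have hGm : AEStronglyMeasurable (uncurry G) (volume.restrict Kφ) :=
      hG.locallyIntegrableOn_grad.aestronglyMeasurable.mono_measure (Measure.restrict_mono hKQ le_rfl)
    have hfrobm : AEStronglyMeasurable (fun z : ℝ × (EuclideanSpace ℝ (Fin 3)) => frobeniusNormSq (G z.1 z.2))
        (volume.restrict Kφ) :=
      LerayHopfProofs.continuous_frobeniusNormSq.comp_aestronglyMeasurable hGm
    have hφc : Continuous (uncurry φ) := hφ.contDiff.continuous
    have hFmK : AEStronglyMeasurable F (volume.restrict Kφ) :=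
      hfrobm.mul hφc.aestronglyMeasurable
    have hFint : Integrable F (volume : Measure (ℝ × (EuclideanSpace ℝ (Fin 3)))) := by
      rw [← integrableOn_iff_integrable_of_support_subset hFsupp]
      refine ⟨hFmK, ?_⟩
      show ∫⁻ z in Kφ, ‖F z‖ₑ < ∞
      calc ∫⁻ z in Kφ, ‖F z‖ₑ ≤ ∫⁻ z in Kφ, ENNReal.ofReal (frobeniusNormSq (G z.1 z.2)) :=
            lintegral_mono fun z => by
              rw [Real.enorm_eq_ofReal (hF0 z)]; exact ENNReal.ofReal_le_ofReal (hFle z)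
        _ < ∞ := hG2 Kφ hKQ hKc
    have hFfin : ∫⁻ z, ENNReal.ofReal (F z) < ∞ := by
      have h := hFint.hasFiniteIntegral
      rw [hasFiniteIntegral_iff_enorm] at h
      simpa only [Real.enorm_eq_ofReal (hF0 _)] using h
    have hboxle : ∫⁻ z in box, ENNReal.ofReal (frobeniusNormSq (G z.1 z.2)) ≤
        ∫⁻ z, ENNReal.ofReal (F z) := by
      calc ∫⁻ z in box, ENNReal.ofReal (frobeniusNormSq (G z.1 z.2))
          = ∫⁻ z in box, ENNReal.ofReal (F z) := by
            refine setLIntegral_congr_fun (measurableSet_Ioo.prod measurableSet_ball) fun z hz => ?_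
            rw [hF]
            dsimp only
            rw [hφ_def, plateauCutoff_eq_one hδ hR hz.1.1.le hz.1.2.le hz.2, mul_one]
        _ ≤ ∫⁻ z, ENNReal.ofReal (F z) := setLIntegral_le_lintegral _ _
    have hLHS : (∫⁻ z in box, ENNReal.ofReal (frobeniusNormSq (G z.1 z.2))).toReal ≤
        ∫ t, ∫ x, frobeniusNormSq (G t x) * φ t x := by
      have e1 : ∫ t, ∫ x, frobeniusNormSq (G t x) * φ t x = ∫ z, F z := by
        rw [show (volume : Measure (ℝ × (EuclideanSpace ℝ (Fin 3)))) = (volume : Measure ℝ).prod (volume : Measure (EuclideanSpace ℝ (Fin 3)))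
          from rfl, integral_prod F hFint]
      have e2 : ∫ z, F z = (∫⁻ z, ENNReal.ofReal (F z)).toReal :=
        integral_eq_lintegral_of_nonneg_ae (Eventually.of_forall hF0) hFint.aestronglyMeasurable
      rw [e1, e2]
      exact ENNReal.toReal_mono hFfin.ne hboxle
    -- (R) the right-hand side is at most `B`
    have hRHS : ∫ t, ∫ x, (‖u t x‖ ^ 2 * (timeDeriv φ t x + ν * (Δ (φ t)) x) +
        (‖u t x‖ ^ 2 + 2 * p t x) * ⟪u t x, gradient (φ t) x⟫ +
        2 * ⟪(0 : ℝ → (EuclideanSpace ℝ (Fin 3)) → (EuclideanSpace ℝ (Fin 3))) t x, u t x⟫ * φ t x) ≤ B.toReal := by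
      set I : ℝ → (EuclideanSpace ℝ (Fin 3)) → ℝ := fun t x => ‖u t x‖ ^ 2 * (timeDeriv φ t x + ν * (Δ (φ t)) x) +
        (‖u t x‖ ^ 2 + 2 * p t x) * ⟪u t x, gradient (φ t) x⟫ +
        2 * ⟪(0 : ℝ → (EuclideanSpace ℝ (Fin 3)) → (EuclideanSpace ℝ (Fin 3))) t x, u t x⟫ * φ t x with hI
      set J₁ : ℝ → (EuclideanSpace ℝ (Fin 3)) → ℝ≥0∞ := fun t x =>
        (Ioo 0 S).indicator (fun t => ENNReal.ofReal (|deriv (timePlateau δ S) t| + ν * (C₂ / R ^ 2))) t *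
          (ball x₀ (3 * R)).indicator (fun x => ‖u t x‖ₑ ^ 2) x with hJ₁
      set Φ : ℝ × (EuclideanSpace ℝ (Fin 3)) → ℝ≥0∞ := fun z => ENNReal.ofReal (C₁ / R) *
        (‖u z.1 z.2‖ₑ ^ (3 : ℝ) + 2 * (‖p z.1 z.2‖ₑ * ‖u z.1 z.2‖ₑ)) with hΦ
      set boxR : Set (ℝ × (EuclideanSpace ℝ (Fin 3))) := Ioo 0 S ×ˢ ball x₀ (3 * R) with hboxR
      have hboxR_m : MeasurableSet boxR := measurableSet_Ioo.prod measurableSet_ball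
      have hboxR_sub : boxR ⊆ strip := prod_mono Subset.rfl (subset_univ _)
      have hpt : ∀ t x, ‖I t x‖ₑ ≤ J₁ t x + boxR.indicator Φ (t, x) := fun t x =>
        enorm_lei_integrand_plateauCutoff_le_ball hδ hR hν.le hC₁ hC₂ u p t x
      -- measurability
      have hJ₁m : ∀ t, AEMeasurable (J₁ t) volume := fun t => by
        by_cases ht : t ∈ Ioo 0 S
        · have hslc : Continuous (u t) :=
            hcont.comp_continuous (f := fun x : (EuclideanSpace ℝ (Fin 3)) => (t, x)) (by fun_prop)
              fun _ => ⟨⟨ht.1.le, ht.2.le⟩, mem_univ _⟩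
          have hm : AEMeasurable (fun x => ‖u t x‖ₑ ^ 2) volume :=
            (hslc.aestronglyMeasurable.aemeasurable.enorm.pow_const 2)
          exact (hm.indicator measurableSet_ball).const_mul _
        · have h0 : J₁ t = fun _ => 0 := by
            funext x; simp only [hJ₁, indicator_of_notMem ht, zero_mul]
          rw [h0]; exact aemeasurable_const
      have hΦm : AEMeasurable Φ (volume.restrict boxR) :=
        (((h1.pow_const _).add ((h2.mul h1).const_mul _)).const_mul _).mono_measure
          (Measure.restrict_mono hboxR_sub le_rfl)
      have hJ₂m : AEMeasurable (boxR.indicator Φ) (volume : Measure (ℝ × (EuclideanSpace ℝ (Fin 3)))) :=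
        (aemeasurable_indicator_iff hboxR_m).2 hΦm
      have hJ₂m' : AEMeasurable (fun t => ∫⁻ x, boxR.indicator Φ (t, x)) volume :=
        hJ₂m.lintegral_prod_right'
      -- (R1) the first part: energy on balls of radius `3R`
      have hT1 : ∫⁻ t, ∫⁻ x, J₁ t x ≤ (2 + ENNReal.ofReal (ν * (C₂ / R ^ 2)) * ENNReal.ofReal S) * E₂ := by
        have h1' : ∀ t, ∫⁻ x, J₁ t x ≤ (Ioo 0 S).indicator
            (fun t => ENNReal.ofReal (|deriv (timePlateau δ S) t| + ν * (C₂ / R ^ 2))) t * E₂ := by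
          intro t
          by_cases ht : t ∈ Ioo 0 S
          · simp only [hJ₁, indicator_of_mem ht]
            rw [lintegral_const_mul' _ _ ENNReal.ofReal_ne_top, lintegral_indicator measurableSet_ball]
            gcongr
            exact hE₂ t ⟨ht.1.le, ht.2.le⟩ x₀
          · simp only [hJ₁, indicator_of_notMem ht, zero_mul, lintegral_zero, le_refl]
        have hmeas : Measurable fun t => ENNReal.ofReal |deriv (timePlateau δ S) t| :=
          (continuous_deriv_timePlateau δ S).abs.measurable.ennreal_ofReal
        calc ∫⁻ t, ∫⁻ x, J₁ t x
            ≤ ∫⁻ t, (Ioo 0 S).indicator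
                (fun t => ENNReal.ofReal (|deriv (timePlateau δ S) t| + ν * (C₂ / R ^ 2))) t * E₂ :=
              lintegral_mono h1'
          _ = (∫⁻ t in Ioo 0 S, ENNReal.ofReal (|deriv (timePlateau δ S) t| + ν * (C₂ / R ^ 2))) * E₂ := by
              rw [lintegral_mul_const' _ _ hE₂top.ne, lintegral_indicator measurableSet_Ioo]
          _ = ((∫⁻ t in Ioo 0 S, ENNReal.ofReal |deriv (timePlateau δ S) t|) +
                ∫⁻ _ in Ioo 0 S, ENNReal.ofReal (ν * (C₂ / R ^ 2))) * E₂ := by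
              rw [← lintegral_add_left hmeas]
              congr 1
              exact lintegral_congr fun t => ENNReal.ofReal_add (abs_nonneg _) hc₂
          _ ≤ (2 + ENNReal.ofReal (ν * (C₂ / R ^ 2)) * ENNReal.ofReal S) * E₂ := by
              gcongr
              · exact lintegral_abs_deriv_timePlateau_le hδ (by linarith)
              · rw [lintegral_const, Measure.restrict_apply_univ, Real.volume_Ioo, sub_zero]
      -- (R2) the second part: the cubic and the pressure terms on the box `(0,S) × B_{3R}(x₀)`
      have hvolbox : volume boxR = VB := by
        rw [hboxR, show (volume : Measure (ℝ × (EuclideanSpace ℝ (Fin 3)))) = (volume : Measure ℝ).prod (volume : Measure (EuclideanSpace ℝ (Fin 3)))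
          from rfl, Measure.prod_prod, Measure.addHaar_ball_center volume x₀, hVB, hV₃]
      have hpbox : ∫⁻ z in boxR, ‖p z.1 z.2‖ₑ ≤ P₂ ^ (1 / 2 : ℝ) * VB ^ (1 / 2 : ℝ) := by
        have hpq : Real.HolderConjugate (2 : ℝ) 2 := ⟨by norm_num, by norm_num, by norm_num⟩
        have h := setLIntegral_le_lintegral_rpow_mul_measure_rpow (μ := volume.restrict strip) h2 hboxR_m hpq
        rw [Measure.restrict_restrict hboxR_m, inter_eq_left.2 hboxR_sub, Measure.restrict_apply hboxR_m,
          inter_eq_left.2 hboxR_sub, hvolbox] at h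
        exact h
      have hT2 : ∫⁻ t, ∫⁻ x, boxR.indicator Φ (t, x) ≤ A₀ * VB + B₀ * (P₂ ^ (1 / 2 : ℝ) * VB ^ (1 / 2 : ℝ)) := by
        have hptΦ : ∀ z ∈ boxR, Φ z ≤ A₀ + B₀ * ‖p z.1 z.2‖ₑ := by
          intro z hz
          have hzt : z.1 ∈ Icc 0 S := ⟨hz.1.1.le, hz.1.2.le⟩
          have hK0' : 0 ≤ K := (norm_nonneg _).trans (hK z.1 hzt z.2)
          have huK : ‖u z.1 z.2‖ₑ ≤ ENNReal.ofReal K := by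
            rw [← ofReal_norm]; exact ENNReal.ofReal_le_ofReal (hK z.1 hzt z.2)
          have hu3 : ‖u z.1 z.2‖ₑ ^ (3 : ℝ) ≤ ENNReal.ofReal (K ^ 3) := by
            calc ‖u z.1 z.2‖ₑ ^ (3 : ℝ) ≤ ENNReal.ofReal K ^ (3 : ℝ) := ENNReal.rpow_le_rpow huK (by norm_num)
              _ = ENNReal.ofReal (K ^ 3) := by
                  rw [ENNReal.rpow_ofNat, ENNReal.ofReal_pow hK0']
          have hpu : ‖p z.1 z.2‖ₑ * ‖u z.1 z.2‖ₑ ≤ ‖p z.1 z.2‖ₑ * ENNReal.ofReal K :=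
            mul_le_mul' le_rfl huK
          calc Φ z = ENNReal.ofReal (C₁ / R) * ‖u z.1 z.2‖ₑ ^ (3 : ℝ) +
                ENNReal.ofReal (C₁ / R) * (2 * (‖p z.1 z.2‖ₑ * ‖u z.1 z.2‖ₑ)) := by
                rw [hΦ]; dsimp only; rw [mul_add]
            _ ≤ ENNReal.ofReal (C₁ / R) * ENNReal.ofReal (K ^ 3) +
                ENNReal.ofReal (C₁ / R) * (2 * (‖p z.1 z.2‖ₑ * ENNReal.ofReal K)) := by
                gcongr
            _ = A₀ + B₀ * ‖p z.1 z.2‖ₑ := by rw [hA₀, hB₀]; ring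
        have h2' : AEMeasurable (fun z : ℝ × (EuclideanSpace ℝ (Fin 3)) => ‖p z.1 z.2‖ₑ) (volume.restrict boxR) :=
          h2.mono_measure (Measure.restrict_mono hboxR_sub le_rfl)
        calc ∫⁻ t, ∫⁻ x, boxR.indicator Φ (t, x)
            = ∫⁻ z, boxR.indicator Φ z ∂((volume : Measure ℝ).prod (volume : Measure (EuclideanSpace ℝ (Fin 3)))) :=
              lintegral_lintegral (f := fun t x => boxR.indicator Φ (t, x)) hJ₂m
          _ = ∫⁻ z in boxR, Φ z := lintegral_indicator hboxR_m _
          _ ≤ ∫⁻ z in boxR, (A₀ + B₀ * ‖p z.1 z.2‖ₑ) := setLIntegral_mono' hboxR_m hptΦ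
          _ = A₀ * volume boxR + B₀ * ∫⁻ z in boxR, ‖p z.1 z.2‖ₑ := by
              rw [lintegral_add_left' aemeasurable_const, lintegral_const, Measure.restrict_apply_univ,
                lintegral_const_mul'' _ h2']
          _ ≤ A₀ * VB + B₀ * (P₂ ^ (1 / 2 : ℝ) * VB ^ (1 / 2 : ℝ)) := by
              rw [hvolbox]
              gcongr
      -- (R3) assembling
      have hbound : ∫⁻ t, ∫⁻ x, ‖I t x‖ₑ ≤ B :=
        calc ∫⁻ t, ∫⁻ x, ‖I t x‖ₑ ≤ ∫⁻ t, ∫⁻ x, (J₁ t x + boxR.indicator Φ (t, x)) :=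
              lintegral_mono fun t => lintegral_mono fun x => hpt t x
          _ = ∫⁻ t, ((∫⁻ x, J₁ t x) + ∫⁻ x, boxR.indicator Φ (t, x)) :=
              lintegral_congr fun t => lintegral_add_left' (hJ₁m t) _
          _ = (∫⁻ t, ∫⁻ x, J₁ t x) + ∫⁻ t, ∫⁻ x, boxR.indicator Φ (t, x) :=
              lintegral_add_right' _ hJ₂m'
          _ ≤ B := add_le_add hT1 hT2
      calc ∫ t, ∫ x, I t x ≤ |∫ t, ∫ x, I t x| := le_abs_self _
        _ = ‖∫ t, ∫ x, I t x‖ := (Real.norm_eq_abs _).symm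
        _ ≤ (∫⁻ t, ENNReal.ofReal ‖∫ x, I t x‖).toReal := norm_integral_le_lintegral_norm _
        _ ≤ B.toReal := by
            refine ENNReal.toReal_mono hBtop ((lintegral_mono fun t => ?_).trans hbound)
            rw [ofReal_norm]
            exact enorm_integral_le_lintegral_enorm _
    -- combining (L), the local energy inequality and (R)
    have hfinal : 2 * ν * (∫⁻ z in box, ENNReal.ofReal (frobeniusNormSq (G z.1 z.2))).toReal ≤
        B.toReal :=
      (mul_le_mul_of_nonneg_left hLHS (by positivity)).trans (hle.trans hRHS)
    have hbox_fin : ∫⁻ z in box, ENNReal.ofReal (frobeniusNormSq (G z.1 z.2)) ≠ ∞ :=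
      (hboxle.trans_lt hFfin).ne
    rw [ENNReal.le_div_iff_mul_le (Or.inl h2ν) (Or.inl ENNReal.ofReal_ne_top),
      ← ENNReal.toReal_le_toReal (ENNReal.mul_ne_top hbox_fin ENNReal.ofReal_ne_top) hBtop,
      ENNReal.toReal_mul, ENNReal.toReal_ofReal (by positivity)]
    linarith
  -- Step 2: exhaustion of `(0, S) × B_R(x₀)` by the boxes with `2δ = S/(n+4)`
  set a : ℕ → ℝ := fun n => S / ((n : ℝ) + 4) with ha
  rcases le_or_gt S 0 with hS0 | hS0
  · simp [Ioo_eq_empty_of_le hS0]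
  have ha_pos : ∀ n, 0 < a n := fun n => by positivity
  have ha_le : ∀ n, 2 * a n ≤ S := fun n => by
    rw [ha]; dsimp only
    rw [← le_div_iff₀' (by norm_num : (0 : ℝ) < 2), div_le_div_iff₀ (by positivity) (by norm_num)]
    nlinarith
  have hanti : ∀ n, a (n + 1) ≤ a n := fun n =>
    div_le_div_of_nonneg_left hS0.le (by positivity) (by push_cast; linarith)
  set boxes : ℕ → Set (ℝ × (EuclideanSpace ℝ (Fin 3))) := fun n => Ioo (a n) (S - a n) ×ˢ ball x₀ R with hboxes
  have hmono : Monotone boxes := monotone_nat_of_le_succ fun n =>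
    prod_mono (Ioo_subset_Ioo (hanti n) (by linarith [hanti n])) Subset.rfl
  have hunion : Ioo 0 S ×ˢ ball x₀ R = ⋃ n, boxes n := by
    refine Subset.antisymm (fun z hz => ?_) (iUnion_subset fun n =>
      prod_mono (Ioo_subset_Ioo (ha_pos n).le (by linarith [ha_pos n])) Subset.rfl)
    have hm : 0 < min z.1 (S - z.1) := lt_min hz.1.1 (sub_pos.2 hz.1.2)
    obtain ⟨n, hn⟩ := exists_nat_gt (S / min z.1 (S - z.1))
    refine mem_iUnion.2 ⟨n, ⟨?_, ?_⟩, hz.2⟩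
    · have h : a n < min z.1 (S - z.1) := by
        rw [ha]; dsimp only
        rw [div_lt_iff₀ (by positivity)]
        rw [div_lt_iff₀ hm] at hn
        nlinarith
      exact h.trans_le (min_le_left _ _)
    · have h : a n < min z.1 (S - z.1) := by
        rw [ha]; dsimp only
        rw [div_lt_iff₀ (by positivity)]
        rw [div_lt_iff₀ hm] at hn
        nlinarith
      linarith [h.trans_le (min_le_right _ _)]
  rw [hunion, setLIntegral_iUnion_of_directed _ hmono.directed_le]
  refine iSup_le fun n => ?_
  have h := key (a n / 2) (by positivity) (by linarith [ha_le n])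
  have e : 2 * (a n / 2) = a n := by ring
  rwa [e] at h


end Gradient

/-! ### Weak continuity, the initial condition and the decay at infinity -/

section Fields

variable {S : ℝ} {u : ℝ → (EuclideanSpace ℝ (Fin 3)) → (EuclideanSpace ℝ (Fin 3))}

/-- **Weak continuity in time on `[0, S]`** for a field jointly continuous and bounded on
`[0, S] × ℝ³`: `t ↦ ∫⟪u(t), φ⟫` is continuous on `[0, S]` for every test field `φ` (dominated
convergence). [folklore] -/
theorem continuousOn_integral_inner_of_continuousOn
    (hcont : ContinuousOn (uncurry u) (Icc 0 S ×ˢ univ)) {K : ℝ}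
    (hK : ∀ t ∈ Icc 0 S, ∀ x, ‖u t x‖ ≤ K) {φ : (EuclideanSpace ℝ (Fin 3)) → (EuclideanSpace ℝ (Fin 3))}
    (hφ : FunctionSpaces.IsTestFunctionOn (⊤ : Opens (EuclideanSpace ℝ (Fin 3))) φ) :
    ContinuousOn (fun t => ∫ x, ⟪u t x, φ x⟫) (Icc 0 S) := by
  have hφc : Continuous φ := hφ.contDiff.continuous
  have hφi : Integrable φ := hφc.integrable_of_hasCompactSupport hφ.hasCompactSupport
  have hslc : ∀ t ∈ Icc 0 S, Continuous (u t) := fun t ht =>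
    hcont.comp_continuous (f := fun x : (EuclideanSpace ℝ (Fin 3)) => (t, x)) (by fun_prop) fun _ => ⟨ht, mem_univ _⟩
  refine continuousOn_of_dominated (bound := fun x => K * ‖φ x‖) (fun t ht =>
    ((hslc t ht).inner hφc).aestronglyMeasurable) (fun t ht => Eventually.of_forall fun x => ?_)
    (hφi.norm.const_mul K) (Eventually.of_forall fun x => ?_)
  · exact (norm_inner_le_norm _ _).trans (mul_le_mul_of_nonneg_right (hK t ht x) (norm_nonneg _))
  · have hpath : ContinuousOn (fun t : ℝ => u t x) (Icc 0 S) :=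
      hcont.comp (f := fun t : ℝ => (t, x)) (by fun_prop) fun t ht => ⟨ht, mem_univ _⟩
    exact hpath.inner continuousOn_const

/-- **The initial condition in `L²_loc`** for a field jointly continuous and bounded on
`[0, S] × ℝ³`: `∫_K |u(t) − u(0)|² → 0` as `t → 0⁺` for every compact `K` (dominated convergence
on the finite measure space `K`). [folklore] -/
theorem tendsto_lintegral_sub_initial_of_continuousOn (hS : 0 < S)
    (hcont : ContinuousOn (uncurry u) (Icc 0 S ×ˢ univ)) {K : ℝ}
    (hK : ∀ t ∈ Icc 0 S, ∀ x, ‖u t x‖ ≤ K) {K' : Set (EuclideanSpace ℝ (Fin 3))} (hK' : IsCompact K') :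
    Tendsto (fun t => ∫⁻ x in K', ‖u t x - u 0 x‖ₑ ^ 2) (𝓝[>] 0) (𝓝 0) := by
  have hslc : ∀ t ∈ Icc 0 S, Continuous (u t) := fun t ht =>
    hcont.comp_continuous (f := fun x : (EuclideanSpace ℝ (Fin 3)) => (t, x)) (by fun_prop) fun _ => ⟨ht, mem_univ _⟩
  have h0I : (0 : ℝ) ∈ Icc 0 S := ⟨le_rfl, hS.le⟩
  -- restrict the filter to `(0, S)`, on which the slices are continuous
  have hF : ∀ t ∈ Ioo 0 S, Measurable fun x => ‖u t x - u 0 x‖ₑ ^ 2 := fun t ht =>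
    (((hslc t (Ioo_subset_Icc_self ht)).sub (hslc 0 h0I)).measurable.enorm.pow_const 2)
  have hbd : ∀ t ∈ Ioo 0 S, ∀ x, ‖u t x - u 0 x‖ₑ ^ 2 ≤ ENNReal.ofReal ((K + K) ^ 2) := by
    intro t ht x
    rw [← ofReal_norm, ← ENNReal.ofReal_pow (norm_nonneg _)]
    refine ENNReal.ofReal_le_ofReal (pow_le_pow_left₀ (norm_nonneg _) ?_ 2)
    exact (norm_sub_le _ _).trans (add_le_add (hK t (Ioo_subset_Icc_self ht) x) (hK 0 h0I x))
  have hfin : ∫⁻ _ in K', ENNReal.ofReal ((K + K) ^ 2) ≠ ∞ := by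
    rw [setLIntegral_const]
    exact ENNReal.mul_ne_top ENNReal.ofReal_ne_top hK'.measure_lt_top.ne
  -- pointwise convergence from the joint continuity
  have hptw : ∀ x, Tendsto (fun t => ‖u t x - u 0 x‖ₑ ^ 2) (𝓝[>] 0) (𝓝 0) := by
    intro x
    have hpath : ContinuousWithinAt (fun t : ℝ => u t x) (Icc 0 S) 0 :=
      (hcont.comp (f := fun t : ℝ => (t, x)) (by fun_prop) fun t ht => ⟨ht, mem_univ _⟩) 0 h0I
    have h1 : Tendsto (fun t : ℝ => u t x) (𝓝[>] 0) (𝓝 (u 0 x)) := by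
      have h2 := hpath.tendsto.mono_left (nhdsWithin_mono _ (Ioo_subset_Icc_self (b := S)))
      rwa [nhdsWithin_Ioo_eq_nhdsGT hS] at h2
    have hc : Continuous fun v : (EuclideanSpace ℝ (Fin 3)) => ‖v - u 0 x‖ₑ ^ 2 :=
      (ENNReal.continuous_pow 2).comp (continuous_id.sub continuous_const).enorm
    have h3 := (hc.tendsto (u 0 x)).comp h1
    simpa [Function.comp_def] using h3
  have hlim := tendsto_lintegral_filter_of_dominated_convergence (μ := volume.restrict K')
    (l := 𝓝[>] (0 : ℝ)) (F := fun t x => ‖u t x - u 0 x‖ₑ ^ 2) (f := fun _ => 0)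
    (fun _ => ENNReal.ofReal ((K + K) ^ 2))
    (by filter_upwards [Ioo_mem_nhdsGT hS] with t ht using hF t ht)
    (by filter_upwards [Ioo_mem_nhdsGT hS] with t ht using Eventually.of_forall (hbd t ht))
    hfin (Eventually.of_forall hptw)
  simpa using hlim

/-- **Decay at spatial infinity of the box energies** for a field `u ∈ L⁴((0,S) × ℝ³)`:
`∫₀ˢ∫_{B_R(x₀)} |u|² → 0` as `|x₀| → ∞` (Hölder against the volume of the box and the tail of
the finite integral `∫∫ |u|⁴`). [folklore] -/
theorem tendsto_lintegral_box_cocompact_of_memLp_four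
    (hu4 : MemLp (uncurry u) 4 (volume.restrict (Ioo 0 S ×ˢ (univ : Set (EuclideanSpace ℝ (Fin 3)))))) (R : ℝ) :
    Tendsto (fun x₀ : (EuclideanSpace ℝ (Fin 3)) => ∫⁻ z in Ioo 0 S ×ˢ ball x₀ R, ‖u z.1 z.2‖ₑ ^ 2) (cocompact (EuclideanSpace ℝ (Fin 3))) (𝓝 0) := by
  set strip : Set (ℝ × (EuclideanSpace ℝ (Fin 3))) := Ioo 0 S ×ˢ (univ : Set (EuclideanSpace ℝ (Fin 3))) with hstrip
  have h1 : AEMeasurable (fun z : ℝ × (EuclideanSpace ℝ (Fin 3)) => ‖u z.1 z.2‖ₑ) (volume.restrict strip) :=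
    hu4.1.aemeasurable.enorm
  have hI₄ : ∫⁻ z in strip, ‖u z.1 z.2‖ₑ ^ (4 : ℝ) < ∞ := lintegral_enorm_rpow_lt_top_of_memLp_four hu4
  have htail := tendsto_setLIntegral_prod_compl_closedBall (Ioo 0 S)
    (F := fun z : ℝ × (EuclideanSpace ℝ (Fin 3)) => ‖u z.1 z.2‖ₑ ^ (4 : ℝ)) (0 : (EuclideanSpace ℝ (Fin 3))) hI₄
  -- the volume of the boxes
  set VB : ℝ≥0∞ := volume (Ioo (0 : ℝ) S) * volume (ball (0 : (EuclideanSpace ℝ (Fin 3))) R) with hVB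
  have hVBtop : VB < ∞ := ENNReal.mul_lt_top measure_Ioo_lt_top measure_ball_lt_top
  have hvolbox : ∀ x₀ : (EuclideanSpace ℝ (Fin 3)), volume (Ioo 0 S ×ˢ ball x₀ R) = VB := fun x₀ => by
    rw [show (volume : Measure (ℝ × (EuclideanSpace ℝ (Fin 3)))) = (volume : Measure ℝ).prod (volume : Measure (EuclideanSpace ℝ (Fin 3))) from rfl,
      Measure.prod_prod, Measure.addHaar_ball_center volume x₀, hVB]
  -- Hölder on each box
  have hbox : ∀ x₀ : (EuclideanSpace ℝ (Fin 3)), ∫⁻ z in Ioo 0 S ×ˢ ball x₀ R, ‖u z.1 z.2‖ₑ ^ 2 ≤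
      (∫⁻ z in Ioo 0 S ×ˢ ball x₀ R, ‖u z.1 z.2‖ₑ ^ (4 : ℝ)) ^ (1 / 2 : ℝ) * VB ^ (1 / 2 : ℝ) := by
    intro x₀
    set box : Set (ℝ × (EuclideanSpace ℝ (Fin 3))) := Ioo 0 S ×ˢ ball x₀ R with hbox_def
    have hbox_m : MeasurableSet box := measurableSet_Ioo.prod measurableSet_ball
    have hsub : box ⊆ strip := prod_mono Subset.rfl (subset_univ _)
    have hpq : Real.HolderConjugate (2 : ℝ) 2 := ⟨by norm_num, by norm_num, by norm_num⟩
    have hf : AEMeasurable (fun z : ℝ × (EuclideanSpace ℝ (Fin 3)) => ‖u z.1 z.2‖ₑ ^ (2 : ℝ)) (volume.restrict box) :=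
      (h1.mono_measure (Measure.restrict_mono hsub le_rfl)).pow_const _
    have h := setLIntegral_le_lintegral_rpow_mul_measure_rpow (μ := volume.restrict box) hf
      MeasurableSet.univ hpq
    rw [Measure.restrict_univ, Measure.restrict_apply_univ, hvolbox x₀] at h
    have e2 : ∀ z : ℝ × (EuclideanSpace ℝ (Fin 3)), ‖u z.1 z.2‖ₑ ^ 2 = ‖u z.1 z.2‖ₑ ^ (2 : ℝ) := fun z =>
      (ENNReal.rpow_two _).symm
    have e4 : ∀ z : ℝ × (EuclideanSpace ℝ (Fin 3)), (‖u z.1 z.2‖ₑ ^ (2 : ℝ)) ^ (2 : ℝ) = ‖u z.1 z.2‖ₑ ^ (4 : ℝ) :=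
      fun z => by rw [← ENNReal.rpow_mul]; norm_num
    simp only [e4] at h
    calc ∫⁻ z in box, ‖u z.1 z.2‖ₑ ^ 2 = ∫⁻ z in box, ‖u z.1 z.2‖ₑ ^ (2 : ℝ) :=
          lintegral_congr fun z => e2 z
      _ ≤ _ := h
  -- the tail bound tends to `0`
  set g : ℕ → ℝ≥0∞ := fun n => (∫⁻ z in Ioo 0 S ×ˢ (closedBall (0 : (EuclideanSpace ℝ (Fin 3))) (n : ℝ))ᶜ, ‖u z.1 z.2‖ₑ ^ (4 : ℝ)) ^
    (1 / 2 : ℝ) * VB ^ (1 / 2 : ℝ) with hg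
  have hg0 : Tendsto g atTop (𝓝 0) := by
    have h1' : Tendsto (fun n : ℕ => (∫⁻ z in Ioo 0 S ×ˢ (closedBall (0 : (EuclideanSpace ℝ (Fin 3))) (n : ℝ))ᶜ,
        ‖u z.1 z.2‖ₑ ^ (4 : ℝ)) ^ (1 / 2 : ℝ)) atTop (𝓝 0) := by
      have h := ((ENNReal.continuous_rpow_const (y := (1 / 2 : ℝ))).tendsto 0).comp htail
      rwa [ENNReal.zero_rpow_of_pos (by norm_num)] at h
    have h2' := ENNReal.Tendsto.mul_const h1'
      (Or.inr (ENNReal.rpow_ne_top_of_nonneg (y := (1 / 2 : ℝ)) (by norm_num) hVBtop.ne))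
    rwa [zero_mul] at h2'
  refine ENNReal.tendsto_nhds_zero.2 fun ε hε => ?_
  obtain ⟨n, hn⟩ := (hg0.eventually (Iic_mem_nhds hε)).exists
  have hmem : {x₀ : (EuclideanSpace ℝ (Fin 3)) | (n : ℝ) + R < ‖x₀‖} ∈ cocompact (EuclideanSpace ℝ (Fin 3)) := by
    refine mem_of_superset ((isCompact_closedBall (0 : (EuclideanSpace ℝ (Fin 3))) ((n : ℝ) + R)).compl_mem_cocompact) ?_
    intro x hx
    rw [mem_compl_iff, mem_closedBall, dist_zero_right, not_le] at hx
    exact hx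
  filter_upwards [hmem] with x₀ hx₀
  have hballsub : ball x₀ R ⊆ (closedBall (0 : (EuclideanSpace ℝ (Fin 3))) (n : ℝ))ᶜ := by
    intro y hy
    rw [mem_compl_iff, mem_closedBall, dist_zero_right, not_le]
    rw [mem_ball, dist_eq_norm] at hy
    have := norm_sub_norm_le x₀ y
    have : ‖x₀ - y‖ = ‖y - x₀‖ := norm_sub_rev _ _
    linarith
  calc ∫⁻ z in Ioo 0 S ×ˢ ball x₀ R, ‖u z.1 z.2‖ₑ ^ 2
      ≤ (∫⁻ z in Ioo 0 S ×ˢ ball x₀ R, ‖u z.1 z.2‖ₑ ^ (4 : ℝ)) ^ (1 / 2 : ℝ) * VB ^ (1 / 2 : ℝ) := hbox x₀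
    _ ≤ g n :=
        mul_le_mul' (ENNReal.rpow_le_rpow (lintegral_mono_set (prod_mono Subset.rfl hballsub))
          (by norm_num)) le_rfl
    _ ≤ ε := hn

end Fields

/-! ### The assembly: Seregin's class -/

section Assembly

variable {S : ℝ} {u : ℝ → (EuclideanSpace ℝ (Fin 3)) → (EuclideanSpace ℝ (Fin 3))}

/-- **A bounded continuous field on `[0, S] × ℝ³` in `L⁴((0,S) × ℝ³)`, suitable on the open slab
with an `L²` pressure, is a local energy solution on `ℝ³ × (0, S)` in Seregin's class**
(`IsLocalEnergySolutionOn S 1 (u 0) u p`; Seregin 2014, Def. B.1): pressure class from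
`p ∈ L²`, every-time energy bound from boundedness, the gradient bound
`uniformLocalGradient_of_suitable_of_bounded`, weak continuity and the initial condition from
the joint continuity, decay from `u ∈ L⁴` of the slab. [cite: Seregin2014, Def. B.1 (B.1.4)–(B.1.8)] -/
theorem isLocalEnergySolutionOn_of_bounded_suitable (hS : 0 < S)
    (hcont : ContinuousOn (uncurry u) (Icc 0 S ×ˢ univ)) {K : ℝ}
    (hK : ∀ t ∈ Icc 0 S, ∀ x, ‖u t x‖ ≤ K)
    (hu4 : MemLp (uncurry u) 4 (volume.restrict (Ioo 0 S ×ˢ (univ : Set (EuclideanSpace ℝ (Fin 3))))))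
    {p : ℝ → (EuclideanSpace ℝ (Fin 3)) → ℝ} (hp2 : MemLp (uncurry p) 2 (volume.restrict (Ioo 0 S ×ˢ (univ : Set (EuclideanSpace ℝ (Fin 3))))))
    (hsuit : IsSuitableWeakSolutionOn (slab (EuclideanSpace ℝ (Fin 3)) (Ioo 0 S) isOpen_Ioo) 1 0 u p) :
    IsLocalEnergySolutionOn S 1 (u 0) u p := by
  have hslc : ∀ t ∈ Icc 0 S, Continuous (u t) := fun t ht =>
    hcont.comp_continuous (f := fun x : (EuclideanSpace ℝ (Fin 3)) => (t, x)) (by fun_prop) fun _ => ⟨ht, mem_univ _⟩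
  obtain ⟨G, hG, hGb⟩ := uniformLocalGradient_of_suitable_of_bounded hcont hK hsuit hp2
  obtain ⟨CG, hCG⟩ := hGb 1 one_pos
  -- the every-time unit-ball energy bound
  set E₁ : ℝ≥0∞ := ENNReal.ofReal (K ^ 2) * volume (ball (0 : (EuclideanSpace ℝ (Fin 3))) 1) with hE₁
  have hE₁top : E₁ < ∞ := ENNReal.mul_lt_top ENNReal.ofReal_lt_top measure_ball_lt_top
  have hE : ∀ t ∈ Icc 0 S, ∀ x₀ : (EuclideanSpace ℝ (Fin 3)), ∫⁻ x in ball x₀ 1, ‖u t x‖ₑ ^ 2 ≤ E₁ := by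
    intro t ht x₀
    calc ∫⁻ x in ball x₀ 1, ‖u t x‖ₑ ^ 2 ≤ ∫⁻ _ in ball x₀ 1, ENNReal.ofReal (K ^ 2) := by
          refine lintegral_mono fun x => ?_
          rw [← ofReal_norm, ← ENNReal.ofReal_pow (norm_nonneg _)]
          exact ENNReal.ofReal_le_ofReal (pow_le_pow_left₀ (norm_nonneg _) (hK t ht x) 2)
      _ = E₁ := by rw [setLIntegral_const, Measure.addHaar_ball_center volume x₀, hE₁]
  refine
    { suitable := hsuit
      pressure := fun K' hK' => ?_
      sliceMeasurable := fun t ht => (hslc t ht).aestronglyMeasurable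
      uniformLocalEnergy := ⟨E₁.toNNReal, fun t ht x₀ => ?_⟩
      uniformLocalGradient := ⟨G, hG, CG, hCG⟩
      weakContinuous := fun φ hφ => continuousOn_integral_inner_of_continuousOn hcont hK hφ
      initial := fun K' hK' => tendsto_lintegral_sub_initial_of_continuousOn hS hcont hK hK'
      decay := fun R _ => tendsto_lintegral_box_cocompact_of_memLp_four hu4 R }
  · -- the pressure: `p ∈ L² ⊂ L^{3/2}` on `(0,S) × K'`, a set of finite volume
    set T : Set (ℝ × (EuclideanSpace ℝ (Fin 3))) := Ioo 0 S ×ˢ K' with hT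
    have hTsub : T ⊆ Ioo 0 S ×ˢ (univ : Set (EuclideanSpace ℝ (Fin 3))) := prod_mono Subset.rfl (subset_univ _)
    have hvolT : volume T < ∞ := by
      rw [hT, show (volume : Measure (ℝ × (EuclideanSpace ℝ (Fin 3)))) = (volume : Measure ℝ).prod (volume : Measure (EuclideanSpace ℝ (Fin 3))) from rfl,
        Measure.prod_prod]
      exact ENNReal.mul_lt_top measure_Ioo_lt_top hK'.measure_lt_top
    haveI : IsFiniteMeasure (volume.restrict T) := ⟨by rwa [Measure.restrict_apply_univ]⟩
    have h2 : MemLp (uncurry p) 2 (volume.restrict T) := hp2.mono_measure (Measure.restrict_mono hTsub le_rfl)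
    have h32le : (3 / 2 : ℝ≥0∞) ≤ 2 := by
      rw [ENNReal.div_le_iff (by norm_num) (by norm_num)]; norm_num
    exact lintegral_enorm_rpow_lt_top_of_memLp_threeHalves (h2.mono_exponent h32le)
  · rw [ENNReal.coe_toNNReal hE₁top.ne]
    exact hE t ht x₀

/-- **Hypothesis `hLE` of the weak-`L³` backward Liouville theorem**: a bounded continuous
solution of the Oseen integral equation on `[0, S]` with weakly divergence-free slices and a
weak-`L³` datum is, paired with its Riesz pressure, a local energy solution on `ℝ³ × (0, S)` in
Seregin's class (Albritton–Barker 2019, proof of Thm. 4.1: "it is not difficult to show that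
`v^{(k)}` is a weak `L^{3,∞}` solution"; Barker–Seregin–Šverák 2018, Def. 1.1, rendered in the
tree's local energy language). [cite: AlbrittonBarker2019, Thm 4.1, proof (arXiv:1811.00502 §4 p. 9)] [cite: BarkerSeregin2016, Def. 1.1] -/
theorem exists_isLocalEnergySolutionOn_of_oseenForward (S : ℝ) (hS : 0 < S)
    (u : ℝ → (EuclideanSpace ℝ (Fin 3)) → (EuclideanSpace ℝ (Fin 3))) (hcont : ContinuousOn (uncurry u) (Icc 0 S ×ˢ univ))
    (hbdd : ∃ C : ℝ, ∀ t ∈ Icc 0 S, ∀ x, ‖u t x‖ ≤ C)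
    (hdiv : ∀ t ∈ Icc 0 S, IsWeaklyDivFree (u t))
    (hmild : ∀ s t : ℝ, 0 ≤ s → s < t → t ≤ S → ∀ x,
      u t x = UnboundedOperators.heatExtension (u s) (t - s) x - oseenDuhamel 1 s u u t x)
    (h0 : FunctionSpaces.MemWeakLp (u 0) 3 volume) :
    ∃ π : ℝ → (EuclideanSpace ℝ (Fin 3)) → ℝ, IsLocalEnergySolutionOn S 1 (u 0) u π := by
  obtain ⟨K, hK⟩ := hbdd
  obtain ⟨p, hu4, hp2, -, hsuit⟩ := exists_rieszPressure_suitable_slab_of_oseenForward hS hcont hK hdiv hmild h0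
  exact ⟨p, isLocalEnergySolutionOn_of_bounded_suitable hS hcont hK hu4 hp2 hsuit⟩

end Assembly

end Literature.Analysis.FluidPDE

end
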